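import Literature.AnabelianGeometry.EtaleTheta.SettingModelKrullCuspSqAxis
import HarnessLib

/-!
# `IsThm16Origin`, C16 and C9 HOLD and the cusp law C3 «`toTheta(I_x) = Δ_Θ`» FAILS at the square-axis Krull model
# `modelκ₂` — the `⊇` half of C3 is INDEPENDENT of the other typed §1 clauses (part 2, proof-only)

S. Mochizuki, *The étale theta function …*, Publ. RIMS **45** (2009) [EtTh], §1 pp. 12–13 (R1, R2, R3, TM; «any
decomposition group of a cusp of `Y^log`»), Thm. 1.6 (i) p. 24, Def. 2.1 p. 35 («`D_x → Π^Θ_X` … maps the inertia group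
`I_x ⊆ D_x` isomorphically onto `Δ_Θ`»), Prop. 2.2 (ii) p. 37 [cite: MochizukiEtTh2009, Def 2.1 p.35]; [SemiAnbd] §6
p. 71 [cite: MochizukiSemiAnbd2006, §6 p.71].  Cell abc-iut, layer L2 (NV lane), seat abc-iut-w5-d051 (gen 4), sequel of
part 1 `SettingModelKrullCuspSqAxis` (`ThetaSetting.modelκ₂ p`: abc-iut-L2-t10's untwisted Krull carrier with the cusp
datum `D_x := c^{2Ẑ} ⋊ G_{ℚ_p}` on the INDEX-2 sub-axis of abc-iut-w5-d165's commutator axis).  PORT of abc-iut-w5-d165's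
`SettingModelKrullCuspThm16Origin` (R2 for the commutator-axis cusp) and abc-iut-L2-t7's `SettingModelKrullCuspLaws`
(C16 / C9), BY NAME; nothing of those files restated.

* §1 the cusp-free clauses transported from `modelκ′` (same `Π^tp_X`, `toZ`, theta quotients, `Y_N`): TM₂, R1, R3;
* §2 the cuspidal decomposition groups of `modelκ₂` (`{g | g.left ∈ γ₀ c^{2Ẑ} γ₀⁻¹}`) lie in `Π^tp_Y`;
* §3 **R2 `modelκ₂_gtpYNFromCusp` for every `N`** — the square sub-axis lies in the commutator axis, which dies in
  `(Π^tp_X)^ell`, so abc-iut-w5-d165's `y`-profile argument goes through VERBATIM;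
* §4 **`ThetaSetting.modelκ₂_isThm16Origin`**, C16 `cusp_unique_modelκ₂`, C9 `exists_continuous_section_modelκ₂`;
* §5 **`not_map_toTheta_inertia_modelκ₂`**: `toTheta(I_x) ≠ Δ_Θ` — the class of `c` itself lies in `Δ_Θ` but not in
  `toTheta(inl c^{2Ẑ})` (its level-`2` Heisenberg `z`-coordinate is `1`, that of every `c^{2t}` modulo `Ker toTheta` is
  EVEN: abc-iut-L6-d6's `hHat_cPow`, abc-iut-w5-d165's `mem_thetaKer_curveκ_iff`); hence `¬ CuspLaws` at `modelκ₂`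
  (through its C3 leg ONLY) and the census certificate
  **`ThetaSetting.exists_isThm16Origin_cuspSection_not_cuspLaws`**: a `ThetaSetting` with `IsEtThOrigin ∧ IsThm16Origin ∧
  Nonempty OncePuncturedData ∧ C16 ∧ C9 ∧ ¬ C3` EXISTS — the `⊇` half of C3 («the cusp inertia GENERATES `Δ_Θ`») is NOT a
  consequence of the other typed §1 clauses available without `IsTateOrigin` (abc-iut-w5-d051's p451482/p455763 derive
  the `⊆` half from `IsTateOrigin` + R2, and exclude `IsTateOrigin` at every product-type cusp carrier such as this one).

PROOF-ONLY (0 definitions).  HONEST LABEL: SEMI-SYNTHETIC model — independence evidence for the typed interface only;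
nothing of [EtTh] asserted; no side taken on [IUTchIII] Cor. 3.12; typed ≠ proved.
-/

noncomputable section

namespace Literature.AnabelianGeometry.EtaleTheta.SettingModel

open Literature.AnabelianGeometry.SemiGraphs Thm16Sub Function _root_.Topology
open scoped commutatorElement Pointwise

variable (p : ℕ) [Fact p.Prime]

/-! ## §1. The cusp-free clauses transported from `modelκ` / `modelκ′` -/

/-- TM₂ at `modelκ₂` (transport of `modelκ_tate2`: the clause does not read the cusp). [cite: MochizukiEtTh2009, §1 p.13] -/
theorem modelκ₂_tate2 :
    ∃ (y₁ z : (ThetaSetting.modelκ₂ p).PiTemp) (ζ r : PadicAlgCl p),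
      y₁ ∈ (ThetaSetting.modelκ₂ p).DtpY ∧ z ∈ (ThetaSetting.modelκ₂ p).DeltaTemp ∧
      (ThetaSetting.modelκ₂ p).toZ z = Multiplicative.ofAdd 1 ∧
      IsPrimitiveRoot ζ ((2 : ℕ+) : ℕ) ∧ r ^ ((2 : ℕ+) : ℕ) = (ThetaSetting.modelκ₂ p).qX ∧
      (∀ y ∈ (ThetaSetting.modelκ₂ p).DtpY, ∃ k : ℕ,
        toEll (ThetaSetting.modelκ₂ p) y * (toEll (ThetaSetting.modelκ₂ p) y₁ ^ k)⁻¹ ∈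
          ellPowersY (ThetaSetting.modelκ₂ p) 2) ∧
      (∀ k : ℕ, toEll (ThetaSetting.modelκ₂ p) y₁ ^ k ∈ ellPowersY (ThetaSetting.modelκ₂ p) 2 ↔
        ((2 : ℕ+) : ℕ) ∣ k) ∧
      (∀ (g : (ThetaSetting.modelκ₂ p).PiTemp) (k : ℕ), (ThetaSetting.modelκ₂ p).aug g ζ = ζ ^ k →
        ∀ y ∈ (ThetaSetting.modelκ₂ p).DtpY,
          toEll (ThetaSetting.modelκ₂ p) (g * y * g⁻¹) * (toEll (ThetaSetting.modelκ₂ p) y ^ k)⁻¹ ∈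
            ellPowersY (ThetaSetting.modelκ₂ p) 2) ∧
      (∀ (g : (ThetaSetting.modelκ₂ p).PiTemp) (m : ℕ), (ThetaSetting.modelκ₂ p).aug g r = ζ ^ m * r →
        toEll (ThetaSetting.modelκ₂ p) (g * z * g⁻¹ * z⁻¹) * (toEll (ThetaSetting.modelκ₂ p) y₁ ^ m)⁻¹ ∈
          ellPowersY (ThetaSetting.modelκ₂ p) 2) :=
  modelκ_tate2 p

/-- R1 at `modelκ₂` (transport). [cite: MochizukiEtTh2009, §1 p.12] -/
theorem kerToZIsCompactlyGenerated_modelκ₂ : KerToZIsCompactlyGenerated (ThetaSetting.modelκ₂ p) :=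
  kerToZIsCompactlyGenerated_modelκ p

/-- R3, first half, at `modelκ₂`. [cite: MochizukiEtTh2009, §1 p.12] -/
theorem isQuotientMap_toTheta_modelκ₂ : IsQuotientMap (ThetaSetting.modelκ₂ p).toTheta :=
  QuotientGroup.isQuotientMap_mk (CurveTheta.thetaKer (curveκ₂ p))

/-- R3, second half, at `modelκ₂` (transport). [cite: MochizukiEtTh2009, §1 p.12] -/
theorem isQuotientMap_thetaToEll_modelκ₂ : IsQuotientMap (ThetaSetting.modelκ₂ p).thetaToEll :=
  isQuotientMap_thetaToEll_modelκ p

/-! ## §2. The cuspidal decomposition groups of `modelκ₂` -/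

/-- Conjugating the cusp datum inside `Γ ⋊_{θ∘1} G_{ℚ_p}` (trivial action): `h · D_x · h⁻¹ = {g | g.left ∈ h.left c^{2Ẑ} h.left⁻¹}`.
[cite: MochizukiEtTh2009, §1 p.13] -/
theorem mem_conjAct_smul_cuspDecompκ₂_iff (h : ConjAct (PiTpκ p)) (g : PiTpκ p) :
    g ∈ h • cuspDecompκ₂ p ↔ g.left ∈ MulAut.conj (ConjAct.ofConjAct h).left • cSqAxisGfp := by
  rw [Subgroup.mem_smul_pointwise_iff_exists, Subgroup.mem_smul_pointwise_iff_exists]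
  constructor
  · rintro ⟨d, hd, rfl⟩
    refine ⟨d.left, (mem_cuspDecompκ₂_iff p d).mp hd, ?_⟩
    rw [ConjAct.smul_def, MulAut.smul_def, MulAut.conj_apply, SemidirectProduct.mul_left, SemidirectProduct.mul_left,
      SemidirectProduct.inv_left]
    simp only [actκ_apply_eq]
  · rintro ⟨c, hc, hcg⟩
    refine ⟨(ConjAct.ofConjAct h)⁻¹ * g * ConjAct.ofConjAct h, ?_, ?_⟩
    · rw [mem_cuspDecompκ₂_iff, SemidirectProduct.mul_left, SemidirectProduct.mul_left, SemidirectProduct.inv_left]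
      simp only [actκ_apply_eq]
      rw [MulAut.smul_def, MulAut.conj_apply] at hcg
      have : (ConjAct.ofConjAct h).left⁻¹ * g.left * (ConjAct.ofConjAct h).left = c := by
        rw [← hcg]; group
      rw [this]; exact hc
    · rw [ConjAct.smul_def]; group

/-- **Every cuspidal decomposition group of `modelκ₂` lies in `Π^tp_Y`** (the square sub-axis sits in the commutator axis,
which has `a`-degree `0`). [cite: MochizukiEtTh2009, §1 p.13] -/
theorem cuspidal_le_GtpY_modelκ₂ {Dc : Subgroup (PiTpκ p)}
    (hDc : (ThetaSetting.modelκ₂ p).IsCuspidalDecompositionGroup Dc) : Dc ≤ (ThetaSetting.modelκ₂ p).GtpY := by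
  obtain ⟨_, -, h, rfl⟩ := hDc
  intro g hg
  change g ∈ h • cuspDecompκ₂ p at hg
  rw [mem_conjAct_smul_cuspDecompκ₂_iff] at hg
  change g ∈ ((krullTwistData p).toZ).ker
  rw [MonoidHom.mem_ker, GfpTwistData.toZ_apply]
  exact conj_cAxisGfp_le_ker_gfpSnd _ (conj_cSqAxisGfp_le_conj_cAxisGfp _ hg)

/-- **The cusp clause of `IsThm16Origin` HOLDS at `modelκ₂`.** [cite: MochizukiEtTh2009, §1 p.13] -/
theorem exists_cuspidal_le_GtpY_modelκ₂ :
    ∃ Dc : Subgroup (ThetaSetting.modelκ₂ p).PiTemp,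
      (ThetaSetting.modelκ₂ p).IsCuspidalDecompositionGroup Dc ∧ Dc ≤ (ThetaSetting.modelκ₂ p).GtpY :=
  ⟨cuspDecompκ₂ p, ⟨(), trivial, 1, by rw [one_smul]⟩, cuspidal_le_GtpY_modelκ₂ p ⟨(), trivial, 1, by rw [one_smul]⟩⟩

/-! ## §3. R2 at `modelκ₂`, for every `N` (port of abc-iut-w5-d165's `modelκ'_gtpYNFromCusp`) -/

/-- **R2 (`Thm16Sub.GtpYNFromCusp`) HOLDS at `modelκ₂` for every `N`** — reading `Π^tp_{Y_N}` off a cusp section returns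
abc-iut-L2-t10's `Π^tp_{Y_N} = Δ^tp_{Y_N} ⋊ G_{K_N}`, because the square sub-axis inertia dies in `(Π^tp_X)^ell`
(verbatim port of abc-iut-w5-d165's argument for the commutator axis). [cite: MochizukiEtTh2009, §1 p.13] -/
theorem modelκ₂_gtpYNFromCusp (N : ℕ+) : GtpYNFromCusp (ThetaSetting.modelκ₂ p) N := by
  intro Dc hDc _ g
  obtain ⟨_, -, h, rfl⟩ := hDc
  set γ₀ : Gfp := (ConjAct.ofConjAct h).left with hγ₀
  have hmem : ∀ d : PiTpκ p, d ∈ h • (ThetaSetting.modelκ₂ p).decomp () ↔ d.left ∈ MulAut.conj γ₀ • cSqAxisGfp :=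
    fun d => mem_conjAct_smul_cuspDecompκ₂_iff p h d
  -- the level-`N` `y`-profile homomorphism on `Π^tp_X` (trivial action!) and on `(Π^tp_X)^ell`
  let yN : PiTpκ p →* Multiplicative (ZMod N) :=
    MonoidHom.mk' (fun d => Multiplicative.ofAdd (levelHom N d.left).y) fun a b => by
      show Multiplicative.ofAdd (levelHom N (a * b).left).y =
        Multiplicative.ofAdd (levelHom N a.left).y * Multiplicative.ofAdd (levelHom N b.left).y
      rw [SemidirectProduct.mul_left, actκ_apply_eq, map_mul, Heis.mul_y, ofAdd_add]
  have hyN : ∀ d : PiTpκ p, yN d = Multiplicative.ofAdd (levelHom N d.left).y := fun _ => rfl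
  have hker : CurveTheta.ellKer (curveκ p) ≤ yN.ker := by
    intro d hd
    have hy : (hHat N (gfpFst d.left)).y = 0 := (((mem_ellKer_curveκ_iff p d).mp hd).1 N).2
    rw [MonoidHom.mem_ker, hyN]
    change Multiplicative.ofAdd (hHat N (gfpFst d.left)).y = 1
    rw [hy, ofAdd_zero]
  let yLevel : (ThetaSetting.modelκ₂ p).GtpEll →* Multiplicative (ZMod N) :=
    QuotientGroup.lift (CurveTheta.ellKer (curveκ p)) yN hker
  have hyLevel : ∀ d : PiTpκ p, yLevel (toEll (ThetaSetting.modelκ₂ p) d) = Multiplicative.ofAdd (levelHom N d.left).y := by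
    intro d
    change yLevel (toEll (ThetaSetting.modelκ p) d) = _
    rw [toEll_modelκ_apply, QuotientGroup.mk'_apply]
    exact QuotientGroup.lift_mk _ hker d
  -- unfold the model's data: `Π^tp_{Y_N} = Δ^tp_{Y_N} ⋊ G_{K_N}`, `Π^tp_Y = Ker(pr₂ ∘ left)`, `aug = right`
  change g ∈ YNκ p N ↔ g ∈ ((krullTwistData p).toZ).ker ∧ augκ p g ∈ (fieldKN (⊥ : IntermediateField ℚ_[p]
    (PadicAlgCl p)) (qModel p) N).fixingSubgroup ∧ _
  rw [YNκ, GfpTwistData.mem_YN, MonoidHom.mem_ker, GfpTwistData.toZ_apply, augκ_apply]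
  constructor
  · rintro ⟨h1, h2⟩
    have h1' : g.left ∈ gfpSnd.ker := dY_le N h1
    refine ⟨h1', h2, ?_⟩
    -- `g = inr(g.right) · inl(g.left)` (trivial action), and `toEll` of each factor lies in the right summand
    have hsplit : g = (SemidirectProduct.inr g.right : PiTpκ p) * SemidirectProduct.inl g.left := by
      refine SemidirectProduct.ext ?_ ?_
      · rw [SemidirectProduct.mul_left, SemidirectProduct.left_inr, SemidirectProduct.right_inr, actκ_apply_eq,
          SemidirectProduct.left_inl, one_mul]
      · rw [SemidirectProduct.mul_right, SemidirectProduct.right_inr, SemidirectProduct.right_inl, mul_one]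
    rw [hsplit, map_mul]
    refine Subgroup.mul_mem_sup ?_ ?_
    · refine ⟨SemidirectProduct.inr g.right, Subgroup.mem_inf.mpr ⟨?_, ?_⟩, rfl⟩
      · rw [hmem, SemidirectProduct.left_inr]; exact one_mem _
      · exact h2
    · have hy : (levelHom N g.left).y = 0 := (Subgroup.mem_comap.mp (Subgroup.mem_inf.mp h1).2).2
      obtain ⟨s, hs⟩ := exists_toEll_inl_eq_pow_κ p N h1' hy
      have hs' : toEll (ThetaSetting.modelκ₂ p) (SemidirectProduct.inl g.left) =
          toEll (ThetaSetting.modelκ₂ p) (SemidirectProduct.inl (bPowGfp s)) ^ (N : ℕ) := hs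
      rw [hs']
      exact (mem_ellPowersY_modelκ'_iff p N _).mpr ⟨bPowGfp s, bPowGfp_mem_ker_gfpSnd s, rfl⟩
  · rintro ⟨h1, h2, h3⟩
    refine ⟨Subgroup.mem_inf.mpr ⟨h1, Subgroup.mem_comap.mpr ⟨levelHom_x_eq_zero h1, ?_⟩⟩, h2⟩
    -- the `y`-profile kills the cusp image and the `N`-th powers
    have hA : (((h • (ThetaSetting.modelκ₂ p).decomp ()) ⊓ ((ThetaSetting.modelκ₂ p).GKN N).comap
        (ThetaSetting.modelκ₂ p).aug.toMonoidHom).map (toEll (ThetaSetting.modelκ₂ p))) ≤ yLevel.ker := by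
      rintro _ ⟨d, hd, rfl⟩
      have hd1 : d.left ∈ MulAut.conj γ₀ • cAxisGfp :=
        conj_cSqAxisGfp_le_conj_cAxisGfp γ₀ ((hmem d).mp (Subgroup.mem_inf.mp hd).1)
      rw [MonoidHom.mem_ker, hyLevel, levelHom_y_eq_zero_of_mem_conj_cAxisGfp N hd1, ofAdd_zero]
    have hB : ellPowersY (ThetaSetting.modelκ₂ p) N ≤ yLevel.ker := by
      intro w hw
      obtain ⟨δ, -, hw'⟩ := (mem_ellPowersY_modelκ'_iff p N w).mp hw
      have hw'' : w = toEll (ThetaSetting.modelκ₂ p) (SemidirectProduct.inl δ) ^ (N : ℕ) := hw'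
      rw [hw'', MonoidHom.mem_ker, map_pow, hyLevel, ← ofAdd_nsmul, nsmul_eq_mul, ZMod.natCast_self, zero_mul,
        ofAdd_zero]
    have hg : toEll (ThetaSetting.modelκ₂ p) g ∈ yLevel.ker := sup_le hA hB h3
    rw [MonoidHom.mem_ker, hyLevel, ← ofAdd_zero] at hg
    exact Multiplicative.ofAdd.injective hg

/-! ## §4. `IsThm16Origin`, C16, C9 at `modelκ₂` -/

/-- **`ThetaSetting.IsThm16Origin` HOLDS at the square-axis Krull model `modelκ₂`** — R1, R2 (all `N`), the cusp clause,
R3 (both quotients) and TM₂. [cite: MochizukiEtTh2009, Thm 1.6 (i) p.24] -/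
theorem _root_.Literature.AnabelianGeometry.EtaleTheta.ThetaSetting.modelκ₂_isThm16Origin :
    (ThetaSetting.modelκ₂ p).IsThm16Origin where
  kerToZ_compactlyGenerated := kerToZIsCompactlyGenerated_modelκ₂ p
  gtpYN_fromCusp := modelκ₂_gtpYNFromCusp p
  exists_cuspidal_le_GtpY := exists_cuspidal_le_GtpY_modelκ₂ p
  isQuotientMap_toTheta := isQuotientMap_toTheta_modelκ₂ p
  isQuotientMap_thetaToEll := isQuotientMap_thetaToEll_modelκ₂ p
  tate2 := modelκ₂_tate2 p

/-- C16 at `modelκ₂`: the cusp is unique (`Pt := Unit`). [cite: MochizukiEtTh2009, Def 2.1 p.35] -/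
theorem cusp_unique_modelκ₂ :
    ∀ x x' : (ThetaSetting.modelκ₂ p).Pt, (ThetaSetting.modelκ₂ p).IsCusp x →
      (ThetaSetting.modelκ₂ p).IsCusp x' → x' = x :=
  fun _ _ _ _ => rfl

/-- C9 at `modelκ₂`: `σ ↦ (1, σ)` is a continuous section of `D_x = c^{2Ẑ} ⋊ G_{ℚ_p} ↠ G_K`.
[cite: MochizukiEtTh2009, Prop 2.2(ii) p.37] -/
theorem exists_continuous_section_modelκ₂ :
    ∀ x : (ThetaSetting.modelκ₂ p).Pt, (ThetaSetting.modelκ₂ p).IsCusp x →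
      ∃ s : ↥(ThetaSetting.modelκ₂ p).GK →* (ThetaSetting.modelκ₂ p).PiTemp, Continuous s ∧
        (∀ σ, s σ ∈ (ThetaSetting.modelκ₂ p).decomp x) ∧
        ∀ σ, (ThetaSetting.modelκ₂ p).aug (s σ) = (σ : GQp p) := by
  intro x _
  refine ⟨(SemidirectProduct.inr : GQp p →* PiTpκ p).comp (ThetaSetting.modelκ₂ p).GK.subtype,
    (continuous_inrκ p).comp continuous_subtype_val, fun σ => ?_, fun σ => rfl⟩
  change (SemidirectProduct.inr (σ : GQp p) : PiTpκ p) ∈ cuspDecompκ₂ p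
  rw [mem_cuspDecompκ₂_iff, SemidirectProduct.left_inr]
  exact Subgroup.one_mem _

/-! ## §5. C3 FAILS at `modelκ₂`: `toTheta(I_x) ≠ Δ_Θ` -/

/-- `inl(c^t)` dies in `(Π^tp_X)^ell` (its Heisenberg levels have `x = y = 0`), so its `Θ`-class lies in `Δ_Θ`.
[cite: MochizukiEtTh2009, §1 p.12] -/
theorem toTheta_inl_cPowGfp_mem_deltaTheta (t : ZH) :
    (ThetaSetting.modelκ₂ p).toTheta (SemidirectProduct.inl (cPowGfp t)) ∈ (ThetaSetting.modelκ₂ p).DeltaTheta := by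
  change (ThetaSetting.modelκ₂ p).thetaToEll ((ThetaSetting.modelκ₂ p).toTheta (SemidirectProduct.inl (cPowGfp t))) = 1
  have hmem : (SemidirectProduct.inl (cPowGfp t) : PiTpκ p) ∈ ((ThetaSetting.modelκ₂ p).thetaToEll.comp
      (ThetaSetting.modelκ₂ p).toTheta).ker := by
    rw [(ThetaSetting.modelκ₂ p).ker_toEll]
    change (SemidirectProduct.inl (cPowGfp t) : PiTpκ p) ∈ CurveTheta.ellKer (curveκ p)
    rw [mem_ellKer_curveκ_iff]
    refine ⟨fun N => ?_, SemidirectProduct.right_inl _⟩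
    rw [SemidirectProduct.left_inl, gfpFst_cPowGfp, hHat_cPow]
    exact ⟨rfl, rfl⟩
  exact hmem

/-- If `inl(c^s)` and `inl(c^t)` have the same `Θ`-class then `s ≡ t (mod 2)` — the level-`2` Heisenberg `z`-coordinate
of `c^{s t⁻¹}` must vanish (`Ker toTheta` = triple-commutator closure, abc-iut-w5-d165's `mem_thetaKer_curveκ_iff`).
[cite: MochizukiEtTh2009, §1 p.12] -/
theorem modN_two_eq_of_toTheta_inl_cPowGfp_eq {s t : ZH}
    (h : (ThetaSetting.modelκ₂ p).toTheta (SemidirectProduct.inl (cPowGfp s)) =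
      (ThetaSetting.modelκ₂ p).toTheta (SemidirectProduct.inl (cPowGfp t))) :
    modN 2 s = modN 2 t := by
  have hker : (SemidirectProduct.inl (cPowGfp s) : PiTpκ p) * (SemidirectProduct.inl (cPowGfp t))⁻¹ ∈
      (ThetaSetting.modelκ₂ p).toTheta.ker := by
    rw [MonoidHom.mem_ker, map_mul, map_inv, h, mul_inv_cancel]
  have hker' : (SemidirectProduct.inl (cPowGfp s * (cPowGfp t)⁻¹) : PiTpκ p) ∈ CurveTheta.thetaKer (curveκ p) := by
    rw [map_mul, map_inv]
    change _ ∈ (CurveTheta.toTheta (curveκ₂ p)).ker at hker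
    rw [CurveTheta.ker_toTheta] at hker
    exact hker
  rw [mem_thetaKer_curveκ_iff] at hker'
  have h2 := hker'.1 2
  rw [SemidirectProduct.left_inl, ← map_inv, ← map_mul, gfpFst_cPowGfp, hHat_cPow] at h2
  have hz : Multiplicative.toAdd (modN 2 (s * t⁻¹)) = 0 := by
    have := congrArg Heis.z h2
    simpa using this
  rw [map_mul, map_inv, toAdd_mul, toAdd_inv] at hz
  exact Multiplicative.toAdd.injective (by linear_combination hz)

/-- **C3 FAILS at `modelκ₂`: `toTheta(I_x) ≠ Δ_Θ`** — the `Θ`-class of `c` lies in `Δ_Θ` but is not the class of any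
`c^{2t}` (`1 ≢ 0 (mod 2)`). [cite: MochizukiEtTh2009, Def 2.1 p.35] -/
theorem not_map_toTheta_inertia_modelκ₂ (x : (ThetaSetting.modelκ₂ p).Pt) :
    ((ThetaSetting.modelκ₂ p).inertia x).map (ThetaSetting.modelκ₂ p).toTheta ≠ (ThetaSetting.modelκ₂ p).DeltaTheta := by
  intro hC3
  have hc : (ThetaSetting.modelκ₂ p).toTheta (SemidirectProduct.inl (cPowGfp (iotaZ (Multiplicative.ofAdd 1)))) ∈
      ((ThetaSetting.modelκ₂ p).inertia x).map (ThetaSetting.modelκ₂ p).toTheta := by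
    rw [hC3]; exact toTheta_inl_cPowGfp_mem_deltaTheta p _
  rw [inertia_modelκ₂_eq, Subgroup.map_map] at hc
  obtain ⟨_, ⟨t, rfl⟩, ht⟩ := hc
  have ht' : (ThetaSetting.modelκ₂ p).toTheta (SemidirectProduct.inl (cPowGfp (t * t))) =
      (ThetaSetting.modelκ₂ p).toTheta (SemidirectProduct.inl (cPowGfp (iotaZ (Multiplicative.ofAdd 1)))) := ht
  have h2 := modN_two_eq_of_toTheta_inl_cPowGfp_eq p ht'
  rw [map_mul, modN_iotaZ, toAdd_ofAdd, Int.cast_one] at h2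
  -- `(modN 2 t)² = ofAdd 1` in `Multiplicative (ZMod 2)` is impossible: squares are `ofAdd (2a) = 1`
  have h3 := congrArg Multiplicative.toAdd h2
  rw [toAdd_mul, toAdd_ofAdd, ← two_mul] at h3
  have h4 : (2 : ZMod ((2 : ℕ+) : ℕ)) = 0 := by decide
  rw [h4, zero_mul] at h3
  exact absurd h3 (by decide)

/-- **`¬ CuspLaws` at `modelκ₂`** — through its C3 leg ONLY (C16 and C9 hold). [cite: MochizukiEtTh2009, Def 2.1 p.35] -/
theorem not_cuspLaws_modelκ₂ : ¬ (ThetaSetting.modelκ₂ p).CuspLaws := fun hL =>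
  not_map_toTheta_inertia_modelκ₂ p () (hL.map_toTheta_inertia () trivial)

/-- The origin profile of `modelκ₂`: guard ✓, `IsThm16Origin` ✓, `OncePuncturedData` inhabited, C16 ✓, C9 ✓, C3 ✗.
[cite: MochizukiEtTh2009, Def 2.1 p.35] -/
theorem modelκ₂_origin_profile :
    (ThetaSetting.modelκ₂ p).IsEtThOrigin ∧ (ThetaSetting.modelκ₂ p).IsThm16Origin ∧
      Nonempty (ThetaSetting.modelκ₂ p).OncePuncturedData ∧
      (∀ x x' : (ThetaSetting.modelκ₂ p).Pt, (ThetaSetting.modelκ₂ p).IsCusp x →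
        (ThetaSetting.modelκ₂ p).IsCusp x' → x' = x) ∧
      (∀ x : (ThetaSetting.modelκ₂ p).Pt, (ThetaSetting.modelκ₂ p).IsCusp x →
        ∃ s : ↥(ThetaSetting.modelκ₂ p).GK →* (ThetaSetting.modelκ₂ p).PiTemp, Continuous s ∧
          (∀ σ, s σ ∈ (ThetaSetting.modelκ₂ p).decomp x) ∧
          ∀ σ, (ThetaSetting.modelκ₂ p).aug (s σ) = (σ : GQp p)) ∧
      (∀ x : (ThetaSetting.modelκ₂ p).Pt,
        ((ThetaSetting.modelκ₂ p).inertia x).map (ThetaSetting.modelκ₂ p).toTheta ≠ (ThetaSetting.modelκ₂ p).DeltaTheta) ∧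
      ¬ (ThetaSetting.modelκ₂ p).CuspLaws :=
  ⟨ThetaSetting.modelκ₂_isEtThOrigin p, ThetaSetting.modelκ₂_isThm16Origin p, nonempty_oncePuncturedData_modelκ₂ p,
    cusp_unique_modelκ₂ p, exists_continuous_section_modelκ₂ p, not_map_toTheta_inertia_modelκ₂ p, not_cuspLaws_modelκ₂ p⟩

/-- **CENSUS CERTIFICATE (independence of the `⊇` half of C3).**  There is a `ThetaSetting` satisfying the guard
`IsEtThOrigin`, ALL of `IsThm16Origin` (R1, R2, cusp, R3, TM₂), carrying the parameter bundle `OncePuncturedData`, with a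
UNIQUE cusp (C16) admitting a CONTINUOUS section (C9), at which nevertheless `toTheta(I_x) ≠ Δ_Θ` for its cusp — so
«the cusp inertia maps ONTO `Δ_Θ`» (C3, [EtTh] Def. 2.1 p. 35) is NOT a consequence of these clauses (witness: the
square-axis Krull model `modelκ₂`; its `⊆` half IS a consequence of `IsTateOrigin` + R2, abc-iut-w5-d051 p451482).
[cite: MochizukiEtTh2009, Def 2.1 p.35] -/
theorem _root_.Literature.AnabelianGeometry.EtaleTheta.ThetaSetting.exists_isThm16Origin_cuspSection_not_cuspLaws :
    ∃ D : ThetaSetting p, D.IsEtThOrigin ∧ D.IsThm16Origin ∧ Nonempty D.OncePuncturedData ∧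
      (∀ x x' : D.Pt, D.IsCusp x → D.IsCusp x' → x' = x) ∧
      (∀ x : D.Pt, D.IsCusp x → ∃ s : ↥D.GK →* D.PiTemp, Continuous s ∧ (∀ σ, s σ ∈ D.decomp x) ∧
        ∀ σ, D.aug (s σ) = (σ : GQp p)) ∧
      (∃ x : D.Pt, D.IsCusp x ∧ (D.inertia x).map D.toTheta ≠ D.DeltaTheta) ∧ ¬ D.CuspLaws :=
  ⟨ThetaSetting.modelκ₂ p, ThetaSetting.modelκ₂_isEtThOrigin p, ThetaSetting.modelκ₂_isThm16Origin p,
    nonempty_oncePuncturedData_modelκ₂ p, cusp_unique_modelκ₂ p, exists_continuous_section_modelκ₂ p,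
    ⟨(), trivial, not_map_toTheta_inertia_modelκ₂ p ()⟩, not_cuspLaws_modelκ₂ p⟩

end Literature.AnabelianGeometry.EtaleTheta.SettingModel

end
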